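import Summits.BirchSwinnertonDyer.Rank1Residual.X1.GeneratorBoundMu
import Summits.BirchSwinnertonDyer.Rank1Residual.X1.GeneratorCountLambda
import HarnessLib

/-!
# Route M at a member of ANY `μ`: the generator count bounds `λ + μ` — `p^B ≤ #(X/𝔪X) ≤ p^{λ+μ}`
# (GREENBERG'S INEQUALITY consumed on the leaf; cell `b2b-bsdres`, unit `b2b-bsdres-eisenstein-p1`,
# gen 17; X1R0-GAPMAP §26)

HONEST FRAMING (run/shared/lean/b2b/bsd-rank1-residual/, verbatim in every file): the goal of the
cell is to DELETE the COMBINATION-SHAPED residual classes of the Birch–Swinnerton-Dyer formula for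
ALL analytic-rank `≤ 1` elliptic curves over `ℚ` — "full BSD formula for every rank `≤ 1` curve in
class `C`" assembled STRICTLY from published theorems — so that the rank-`≤ 1` remainder becomes
exactly the CONSTRUCTION-SHAPED classes, which are TYPED (missing-input `Prop`s), NOT attempted.
This is not "finishing BSD". Sub-cell `b2b-bsdres-eisenstein-p1` (CLASS-OWNERS row "X1 (r = 0)"):
research route; NO CLAIM BEYOND STATED CLASSES; nothing here changes a label; nothing is booked.
THEOREMS ONLY — no definition, no named fact, no typed input introduced, nothing about any
particular curve asserted.

## What and why

`X1/GeneratorCountLambda.lean` (gen 17, FILE 1) turned the generator count `GeneratorCountGE W p B`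
into `λ_alg ≥ B` at a `μ_an = 0` member; `X1/GeneratorBoundMu.lean` (gen 17, FILE 2) proved
GREENBERG'S INEQUALITY `#(X/𝔪X) ≤ p^{λ(X)+μ(X)}` for every finitely generated torsion `Λ`-module
without nonzero finite submodules. THIS FILE consumes it at a member of ANY `μ`:

* §1 `mu_le_of_analyticMuLE`: at a good ordinary Eisenstein pair, `AnalyticMuLE W p m` (a
  coefficient of `ϖ·L_p` of norm `> p^{-(m+1)}`, typed certificate) gives `μ(X(E/ℚ_∞)) ≤ m` for every
  cyclotomic dual datum (Kato–Wuthrich divisibility `μ(f_E) ≤ μ(f_E·h) ≤ m`; the `m = 0` case is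
  `MuPart.mu_eq_zero_of_analyticMuLE_zero`).
* §2 `AlgebraicLambdaMem.of_generatorCount_of_analyticMuLE`: `GeneratorCountGE W p B ∧
  AnalyticMuLE W p m ∧ NoFiniteSubmoduleAt p W ⇒ λ_alg ∈ {d | B ≤ d + m}` (`p^B ≤ #(X/𝔪X) ≤
  p^{λ+μ} ≤ p^{λ+m}`); with the Newton certificate `{d | ∃ v, (d,v) ∈ S ∧ B ≤ v ∧ B ≤ d + m}`.
* §3 the leaf ENDS at a `μ ≥ 1` member (μ-part `MuPartAt W p` typed, as in every `…_of_muPartAt_…`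
  end of the count files): gap check `∀ (d,v) ∈ S, B ≤ v → B ≤ d + m → Even d → d ≤ n → n ≤ d+1`,
  generic / Prop. 4.15 (ii) / intersected, and composed with the count `#S + 1` at a member with
  `p ∤ #E(ℚ)_tors` (`GeneratorCountAnomalous.generatorCountGE_of_dvd_localTamagawaNumber_atP`, `hloc`
  discharged by V79 `GeneratorCountAnomalousLeaf.Leaf.hloc_of_prop24`).

CENSUS (EVIDENCE, outside the kernel; `routeM17/v82.py`): this is the census rule "`deg D ≥ B_j − μ_j`
at member `j`" (route T's `λ + p^m μ ≥ B_m` at layer `m = 0`), so far used only through the TYPED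
`AlgebraicLambdaGE`; in the kernel it moves `249158q 335699d @3` (`TAM+LB`, member 2: `μ = 1`,
`t₀ = 3`, `B = 4`, atoms `Q₂` of slope `3/2` and `Q₄`/`Q₆`: M₀ kills the shallow atom, `B ≤ d + μ`
kills `Q₂` alone (`2 + 1 < 4`)) and the `M:paper` class `356590s@3` (member 2: `μ = 1`, `t₀ = 3`,
`B = 4`; the `ord_𝔪`-weight variant V67 of X1R0-GAPMAP §22 is no longer needed) to kernel-shaped.
Nothing is booked by this file.

References: [GreenbergLNM1716] §1 p. 60, Prop. 3.10, Thm. 4.1, §4 Lemma 4.2, Prop. 4.14/4.15,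
p. 137; [GreenbergVatsal2000] p. 2 (1)–(2), p. 4; [Washington1997] §13.2; [Wuthrich2014] Thm. 16;
X1R0-GAPMAP §14.1, §21–§26.
-/

noncomputable section

open scoped Classical MatrixGroups ModularForm

open Function Field NumberField IsDedekindDomain WeierstrassCurve PowerSeries CongruenceSubgroup
  Literature.NumberTheory.EllipticCurves Literature.NumberTheory.GaloisRepresentations
  Literature.NumberTheory.GaloisCohomology Summit.BirchSwinnertonDyer.Rank1Residual.GaloisImage
  Literature.NumberTheory.EllipticCurves.IwasawaAlgebra IsLocalRing
  Literature.NumberTheory.EllipticCurves.ModularForms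
  Literature.NumberTheory.EllipticCurves.Rank1Residual
  Literature.NumberTheory.EllipticCurves.Greenberg1999
  Summit.BirchSwinnertonDyer.BirchSwinnertonDyer.Theorems.Rank1ResidualX1Defs
  Summit.BirchSwinnertonDyer.Rank1Residual.X1.MuLambda
  Summit.BirchSwinnertonDyer.Rank1Residual.X1.MuPart
  Summit.BirchSwinnertonDyer.Rank1Residual.X1.ParitySqueeze
  Summit.BirchSwinnertonDyer.Rank1Residual.X1.TamagawaSqueeze
  Summit.BirchSwinnertonDyer.Rank1Residual.X1.FactorSqueeze
  Summit.BirchSwinnertonDyer.Rank1Residual.X1.GeneratorSqueeze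
  Summit.BirchSwinnertonDyer.Rank1Residual.X1.GeneratorCountAnomalous
  Summit.BirchSwinnertonDyer.Rank1Residual.X1.GeneratorCountSqueeze
  Summit.BirchSwinnertonDyer.Rank1Residual.X1.GeneratorCountSqueezeFacts
  Summit.BirchSwinnertonDyer.Rank1Residual.X1.GeneratorCountAnomalousLeaf
  Summit.BirchSwinnertonDyer.Rank1Residual.X1.GeneratorCountLambda
  Summit.BirchSwinnertonDyer.Rank1Residual.X1.GeneratorBoundMu
  Summit.BirchSwinnertonDyer.Rank1Residual.Additive
open Literature.NumberTheory.GaloisRepresentations.DiscreteGaloisModule (unramifiedSubgroup)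

set_option autoImplicit false

namespace Summit.BirchSwinnertonDyer.Rank1Residual.X1.GeneratorCountMu

variable {W : WeierstrassCurve ℚ} [W.IsElliptic] [W.IsGloballyMinimal] {p : ℕ} [hp : Fact p.Prime]

/-! ## §1. `μ_an ≤ m ⇒ μ(X(E/ℚ_∞)) ≤ m` -/

/-- **`μ(X(E/ℚ_∞)) ≤ m` from the certificate `AnalyticMuLE W p m`** at a good ordinary Eisenstein
pair, `p ≠ 2` (Wuthrich Thm. 16 + modularity, PUBLISHED): `char X = (g)`, `ι(g·h) = ϖ·L_p` and a
coefficient of `ϖ·L_p` of norm `> p^{-(m+1)}` give `μ(X) = μ(g) ≤ μ(g·h) ≤ m` — Kato's direction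
alone. [cite: GreenbergVatsal2000, p. 2, (2)] [cite: Wuthrich2014, Thm. 16 (p. 397)] -/
theorem mu_le_of_analyticMuLE (hW16 : Wuthrich2014.charIdeal_dvd_padicLFunction)
    (hmod : nonempty_modularParametrizationData)
    (hp2 : p ≠ 2) (hgood : W.HasGoodReductionAtPrime p) (hord : ¬ (p : ℤ) ∣ W.frobeniusTrace p)
    (hred : ¬ W.HasIrreducibleModPGaloisRep p) {m : ℕ} (han : AnalyticMuLE W p m)
    {κ : ZpExtension ℚ p} {γ : Field.absoluteGaloisGroup ℚ}
    (hκ : κ.IsCyclotomic) (hγ : κ.IsTopGenerator γ) (hγ' : IsCyclotomicVariable p γ)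
    (D : W.SelmerDualData κ γ) : D.mu ≤ m := by
  haveI : NeZero (W.conductorNorm ℤ) := ⟨(W.conductorNorm_pos_holds).ne'⟩
  haveI : Module.Finite (IwasawaAlgebra p) D.X := D.module_finite_holds hγ
  obtain ⟨hD, f, ϖ, g, h, hf, hϖ, hchar, hι⟩ :=
    isTorsion_and_exists_factorisation hW16 hmod hp2 hgood hord hred hκ hγ hγ' D
  have hgh : g * h ≠ 0 := mul_ne_zero_of_iota_eq hgood hord hf hϖ D hι
  have hg0 : g ≠ 0 := fun h0 ↦ hgh (by rw [h0, zero_mul])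
  have hh : h ≠ 0 := fun h0 ↦ hgh (by rw [h0, mul_zero])
  obtain ⟨n, hn⟩ := han f hf ϖ hϖ
  rw [← hι] at hn
  rw [SelmerDualData.mu, ← mu_generator_eq_muInvariant D.X hD hg0 hchar]
  exact (mu_le_mu_mul hg0 hh).trans (mu_le_of_lt_norm_coeff hn)

/-! ## §2. The count bounds `λ + μ`: `GeneratorCountGE W p B ∧ μ_an ≤ m ⇒ λ_alg ≥ B − m` -/

/-- **`λ_alg ∈ {d | B ≤ d + m}` from the generator count at a member with `μ_an ≤ m`.** `W/ℚ`
globally minimal elliptic, `p ≠ 2` good ordinary with `E[p]` reducible; granted Wuthrich 2014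
Thm. 16 (`hW16`) and modularity (`hmod`): if `AnalyticMuLE W p m`, `X(E/ℚ_∞)` has no nonzero finite
submodule (`NoFiniteSubmoduleAt p W`) and needs at least `B` generators (`GeneratorCountGE W p B`),
then `B ≤ λ(X) + m` for every cyclotomic torsion dual datum: `p^B ≤ #(X/𝔪X) ≤ p^{λ(X)+μ(X)}`
(GREENBERG'S INEQUALITY, `GeneratorBoundMu.natCard_quotient_maximalIdeal_le_pow_lambda_add_mu`) and
`μ(X) ≤ m` (§1). [cite: GreenbergLNM1716, §1 p. 60, p. 137 and Prop. 4.14]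
[cite: Washington1997, §13.2] [cite: Wuthrich2014, Thm. 16 (p. 397)] -/
theorem AlgebraicLambdaMem.of_generatorCount_of_analyticMuLE
    (hW16 : Wuthrich2014.charIdeal_dvd_padicLFunction) (hmod : nonempty_modularParametrizationData)
    (hp2 : p ≠ 2) (hgood : W.HasGoodReductionAtPrime p) (hord : ¬ (p : ℤ) ∣ W.frobeniusTrace p)
    (hred : ¬ W.HasIrreducibleModPGaloisRep p) {m : ℕ} (hμ : AnalyticMuLE W p m)
    (hnf : NoFiniteSubmoduleAt p W) {B : ℕ} (hB : GeneratorCountGE W p B) :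
    AlgebraicLambdaMem W p {d | B ≤ d + m} := by
  intro κ γ hκ hγ hγ' D _ hXt
  have hμD : D.mu ≤ m := mu_le_of_analyticMuLE hW16 hmod hp2 hgood hord hred hμ hκ hγ hγ' D
  have hXtors : Module.IsTorsion (IwasawaAlgebra p) D.X := hXt
  have hle := GeneratorBoundMu.natCard_quotient_maximalIdeal_le_pow_lambda_add_mu D.X hXtors
    (hnf hκ hγ hγ' D hXt)
  have hBle : B ≤ lambdaInvariant p D.X + muInvariant p D.X :=
    (Nat.pow_le_pow_iff_right (Nat.Prime.one_lt hp.out)).mp ((hB κ γ hκ hγ hγ' D hXt).trans hle)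
  have hμD' : muInvariant p D.X ≤ m := hμD
  show B ≤ lambdaInvariant p D.X + m
  omega

/-- **The count certificate with BOTH weights at a member with `μ_an ≤ m`:
`λ_alg ∈ {d | ∃ v, (d, v) ∈ S ∧ B ≤ v ∧ B ≤ d + m}`** — LEMMA M₀
(`GeneratorCountSqueeze.AlgebraicLambdaMem.of_generatorCount`) intersected with §2.
[cite: GreenbergLNM1716, §4 Lemma 4.2, p. 137] [cite: Washington1997, §13.2] [cite: Wuthrich2014, Thm. 16 (p. 397)] -/
theorem AlgebraicLambdaMem.of_generatorCount_of_analyticMuLE_newton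
    (hW16 : Wuthrich2014.charIdeal_dvd_padicLFunction) (hmod : nonempty_modularParametrizationData)
    (hp2 : p ≠ 2) (hgood : W.HasGoodReductionAtPrime p) (hord : ¬ (p : ℤ) ∣ W.frobeniusTrace p)
    (hred : ¬ W.HasIrreducibleModPGaloisRep p) (hL : W.entireLFunction 1 ≠ 0) {m : ℕ}
    (hμ : AnalyticMuLE W p m) (hnf : NoFiniteSubmoduleAt p W) {B : ℕ} {S : Set (ℕ × ℕ)}
    (hB : GeneratorCountGE W p B) (hS : AnalyticLamConstValDivisorSet W p S) :
    AlgebraicLambdaMem W p {d | ∃ v, (d, v) ∈ S ∧ B ≤ v ∧ B ≤ d + m} := by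
  refine AlgebraicLambdaMem.mono ?_
    ((GeneratorCountSqueeze.AlgebraicLambdaMem.of_generatorCount hW16 hmod hp2 hgood hord hred hL hnf
      hB hS).inter
    (AlgebraicLambdaMem.of_generatorCount_of_analyticMuLE hW16 hmod hp2 hgood hord hred hμ hnf hB))
  rintro d ⟨⟨v, hv, hBv⟩, hBd⟩
  exact ⟨v, hv, hBv, hBd⟩

/-! ## §3. The leaf ends at a member of any `μ` -/

/-- **ROUTE M at a member of any `μ` with BOTH weights: `MuPartAt ∧ μ_an ≤ m ∧ λ_an = n ∧ (count B) ∧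
(Newton data S) ∧ gap ⇒ BSD(E,p)`** on the leaf X1 ∩ {r = 0}; gap check
`∀ (d,v) ∈ S, B ≤ v → B ≤ d + m → Even d → d ≤ n → n ≤ d + 1`; `NoFiniteSubmoduleAt` typed here.
EXAMPLE `249158q2@3`: `m = 1`, `n = 6`, `B = 4`, `S = {(0,1),(2,4),(4,2),(6,5)}` (divisors
`p^{μ'}·D`, `μ' ≤ 1`): `(2,4)` passes `B ≤ v` but not `B ≤ d + m`. Facts `hW16`, `hGr`, `h310`,
`hmod`, `hGZK` PUBLISHED. [cite: GreenbergLNM1716, Prop. 3.10, Thm. 4.1, §4 Lemma 4.2, p. 137]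
[cite: Washington1997, §13.2] [cite: Wuthrich2014, Thm. 16 (p. 397)] -/
theorem Leaf.bsdp_of_muPartAt_of_generatorCount_mu
    (hW16 : Wuthrich2014.charIdeal_dvd_padicLFunction) (hGr : greenberg_charValue_rankZero)
    (h310 : prop310_selmerCorank_mod_two_eq_lambdaInvariant)
    (hmod : nonempty_modularParametrizationData)
    (hGZK : rank_eq_analyticRank_of_analyticRank_le_one) (hL : RankZero.Leaf W p)
    (hnf : NoFiniteSubmoduleAt p W) (hμP : MuPartAt W p) {m n B : ℕ} {S : Set (ℕ × ℕ)}
    (hμ : AnalyticMuLE W p m) (hlam : AnalyticLambdaEq W p n) (hB : GeneratorCountGE W p B)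
    (hS : AnalyticLamConstValDivisorSet W p S)
    (hgap : ∀ d v, (d, v) ∈ S → B ≤ v → B ≤ d + m → Even d → d ≤ n → n ≤ d + 1) : BSDp W p :=
  have hX := isClassX1_of_classX1 hL.classX1
  GeneratorSqueeze.Leaf.bsdp_of_lambdaMem hW16 hGr h310 hmod hGZK hL hμP hlam
    (AlgebraicLambdaMem.of_generatorCount_of_analyticMuLE_newton hW16 hmod hX.two_ne
      hX.hasGoodReductionAtPrime hX.not_dvd_frobeniusTrace hX.not_hasIrreducibleModPGaloisRep
      (entireLFunction_one_ne_zero_of_analyticRank_eq_zero hmod W hL.analyticRank_eq_zero) hμ hnf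
      hB hS)
    fun d ⟨v, hv, hBv, hBd⟩ ↦ hgap d v hv hBv hBd

/-- **The same with `NoFiniteSubmoduleAt` BY NAME from Greenberg 1999 Prop. 4.15 (ii)** (the leaf
supplies `p ≥ 3` and good ordinary reduction). [cite: GreenbergLNM1716, Prop. 3.10, Thm. 4.1, Prop. 4.15 (ii), p. 137]
[cite: Washington1997, §13.2] [cite: Wuthrich2014, Thm. 16 (p. 397)] -/
theorem Leaf.bsdp_of_muPartAt_of_generatorCount_mu_of_prop415
    (hW16 : Wuthrich2014.charIdeal_dvd_padicLFunction) (hGr : greenberg_charValue_rankZero)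
    (h310 : prop310_selmerCorank_mod_two_eq_lambdaInvariant)
    (h415 : prop415ii_noFiniteSubmodule_of_ordinary_or_multiplicative)
    (hmod : nonempty_modularParametrizationData)
    (hGZK : rank_eq_analyticRank_of_analyticRank_le_one) (hL : RankZero.Leaf W p)
    (hμP : MuPartAt W p) {m n B : ℕ} {S : Set (ℕ × ℕ)}
    (hμ : AnalyticMuLE W p m) (hlam : AnalyticLambdaEq W p n) (hB : GeneratorCountGE W p B)
    (hS : AnalyticLamConstValDivisorSet W p S)
    (hgap : ∀ d v, (d, v) ∈ S → B ≤ v → B ≤ d + m → Even d → d ≤ n → n ≤ d + 1) : BSDp W p :=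
  have hX := isClassX1_of_classX1 hL.classX1
  Leaf.bsdp_of_muPartAt_of_generatorCount_mu hW16 hGr h310 hmod hGZK hL
    (noFiniteSubmoduleAt_of_prop415ii h415 (lt_of_le_of_ne (Nat.Prime.two_le hp.out)
      (Ne.symm hX.two_ne)) hX.hasGoodReductionAtPrime hX.not_dvd_frobeniusTrace) hμP hμ hlam hB hS
    hgap

/-- **Intersected form, all inputs named** (a further certificate `A'`: route D, route C, or one read
at an isogenous member via `GeneratorCountLambda.AlgebraicLambdaMem.of_isIsogenous`).
[cite: GreenbergLNM1716, Prop. 3.10, Thm. 4.1, Prop. 4.15 (ii), pp. 132, 137] [cite: Washington1997, §13.2]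
[cite: Wuthrich2014, Thm. 16 (p. 397)] -/
theorem Leaf.bsdp_of_muPartAt_of_generatorCount_mu_inter_of_prop415
    (hW16 : Wuthrich2014.charIdeal_dvd_padicLFunction) (hGr : greenberg_charValue_rankZero)
    (h310 : prop310_selmerCorank_mod_two_eq_lambdaInvariant)
    (h415 : prop415ii_noFiniteSubmodule_of_ordinary_or_multiplicative)
    (hmod : nonempty_modularParametrizationData)
    (hGZK : rank_eq_analyticRank_of_analyticRank_le_one) (hL : RankZero.Leaf W p)
    (hμP : MuPartAt W p) {m n B : ℕ} {S : Set (ℕ × ℕ)} {A' : Set ℕ}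
    (hμ : AnalyticMuLE W p m) (hlam : AnalyticLambdaEq W p n) (hB : GeneratorCountGE W p B)
    (hS : AnalyticLamConstValDivisorSet W p S) (hA' : AlgebraicLambdaMem W p A')
    (hgap : ∀ d v, (d, v) ∈ S → B ≤ v → B ≤ d + m → d ∈ A' → Even d → d ≤ n → n ≤ d + 1) :
    BSDp W p :=
  have hX := isClassX1_of_classX1 hL.classX1
  GeneratorSqueeze.Leaf.bsdp_of_lambdaMem hW16 hGr h310 hmod hGZK hL hμP hlam
    ((AlgebraicLambdaMem.of_generatorCount_of_analyticMuLE_newton hW16 hmod hX.two_ne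
      hX.hasGoodReductionAtPrime hX.not_dvd_frobeniusTrace hX.not_hasIrreducibleModPGaloisRep
      (entireLFunction_one_ne_zero_of_analyticRank_eq_zero hmod W hL.analyticRank_eq_zero) hμ
      (noFiniteSubmoduleAt_of_prop415ii h415 (lt_of_le_of_ne (Nat.Prime.two_le hp.out)
        (Ne.symm hX.two_ne)) hX.hasGoodReductionAtPrime hX.not_dvd_frobeniusTrace) hB hS).inter hA')
    fun d ⟨⟨v, hv, hBv, hBd⟩, hd⟩ ↦ hgap d v hv hBv hBd hd

/-- **The count `#S + 1` on the leaf at a member with `p ∤ #E(ℚ)_tors`** (`δ = 0`, `a = 1`: no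
`ℚ_p`-point needed): places `S ∌ p` with `p ∣ c_v(E)` ⇒ `GeneratorCountGE W p (#S + 1)` — FILE 3
`GeneratorCountAnomalous.generatorCountGE_of_dvd_localTamagawaNumber_atP` with `hloc` discharged by
V79 (`GeneratorCountAnomalousLeaf.Leaf.hloc_of_prop24`, Greenberg Prop. 2.4 `hGrK` by name). Named facts
`hPT`, `hGrK`. [cite: GreenbergLNM1716, §2 Prop. 2.4, §3 Lemma 3.4, §5 pp. 114–118, p. 137] -/
theorem Leaf.generatorCountGE_atP_of_prop24 (hPT : poitouTate_selmerStructure_duality ℚ)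
    (hGrK : imKummer_ge_strictCondition_goodOrdinary) (hL : RankZero.Leaf W p)
    (htors : ¬ p ∣ W.torsionOrder)
    (S : Finset (HeightOneSpectrum (𝓞 ℚ))) (hSp : ∀ v ∈ S, ((p : ℕ) : 𝓞 ℚ) ∉ v.asIdeal)
    (hcv : ∀ v ∈ S,
      p ∣ (W.baseChange (v.adicCompletion ℚ)).localTamagawaNumber (v.adicCompletionIntegers ℚ))
    (vp : HeightOneSpectrum (𝓞 ℚ)) (hvp : ((p : ℕ) : 𝓞 ℚ) ∈ vp.asIdeal) :
    GeneratorCountGE W p (S.card + 1) :=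
  generatorCountGE_of_dvd_localTamagawaNumber_atP (isClassX1_of_classX1 hL.classX1).two_ne hPT htors
    (GeneratorCountAnomalousLeaf.Leaf.hloc_of_prop24 hGrK hL) S hSp hcv vp hvp

/-- **ROUTE M at a `μ ≥ 1` member with `p ∤ #E(ℚ)_tors`, count `#S + 1`, BOTH weights:**
`MuPartAt ∧ μ_an ≤ m ∧ λ_an = n ∧ (p ∣ c_v on S) ∧ (Newton data S') ∧ gap ⇒ BSD(E,p)`, gap check
with `#S + 1 ≤ v ∧ #S + 1 ≤ d + m`. The census classes `249158q 335699d 356590s @3` close this way at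
their member `2` (`m = 1`, `#S = 3`). [cite: GreenbergLNM1716, §2 Prop. 2.4, §3 Lemma 3.4, Prop. 3.10, Thm. 4.1, §5 pp. 114–118, p. 137]
[cite: Washington1997, §13.2] [cite: Wuthrich2014, Thm. 16 (p. 397)] -/
theorem Leaf.bsdp_of_muPartAt_of_tamagawaCountAtP_mu_of_prop24
    (hW16 : Wuthrich2014.charIdeal_dvd_padicLFunction) (hGr : greenberg_charValue_rankZero)
    (h310 : prop310_selmerCorank_mod_two_eq_lambdaInvariant)
    (h415 : prop415ii_noFiniteSubmodule_of_ordinary_or_multiplicative)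
    (hmod : nonempty_modularParametrizationData)
    (hGZK : rank_eq_analyticRank_of_analyticRank_le_one)
    (hPT : poitouTate_selmerStructure_duality ℚ) (hGrK : imKummer_ge_strictCondition_goodOrdinary)
    (hL : RankZero.Leaf W p) (htors : ¬ p ∣ W.torsionOrder)
    (hμP : MuPartAt W p) {m n : ℕ} {S' : Set (ℕ × ℕ)} (hμ : AnalyticMuLE W p m)
    (hlam : AnalyticLambdaEq W p n)
    (S : Finset (HeightOneSpectrum (𝓞 ℚ))) (hSp : ∀ v ∈ S, ((p : ℕ) : 𝓞 ℚ) ∉ v.asIdeal)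
    (hcv : ∀ v ∈ S,
      p ∣ (W.baseChange (v.adicCompletion ℚ)).localTamagawaNumber (v.adicCompletionIntegers ℚ))
    (vp : HeightOneSpectrum (𝓞 ℚ)) (hvp : ((p : ℕ) : 𝓞 ℚ) ∈ vp.asIdeal)
    (hS : AnalyticLamConstValDivisorSet W p S')
    (hgap : ∀ d v, (d, v) ∈ S' → S.card + 1 ≤ v → S.card + 1 ≤ d + m → Even d → d ≤ n →
      n ≤ d + 1) : BSDp W p :=
  Leaf.bsdp_of_muPartAt_of_generatorCount_mu_of_prop415 hW16 hGr h310 h415 hmod hGZK hL hμP hμ hlam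
    (Leaf.generatorCountGE_atP_of_prop24 hPT hGrK hL htors S hSp hcv vp hvp) hS hgap

end Summit.BirchSwinnertonDyer.Rank1Residual.X1.GeneratorCountMu

end
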